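import Summits.AtomisticToContinuum.BoseEinsteinCondensation.Theorems.BECFeynmanVortexAreaTorusGroundStateOfRegularity
import Summits.AtomisticToContinuum.BoseEinsteinCondensation.Theorems.BECConjugateDominationHardCoreExtensionGroundStateRegularity
import HarnessLib

/-!
# Route `BECFeynmanVortexArea`, support item `TorusGroundState` (stmt-AtomisticToContinuum-12606) —
# closing theorem

For every bounded repulsive finite-range pair potential `v`, every `N` and every `L > 0`, the
periodic `N`-body energy on the torus of side `L` is attained in the periodic `C¹` Bose class
`PeriodicTrialState N L` by a real, strictly positive, translation-invariant state, and is finite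
(the route decl `TorusGroundState`). Composition of two tree results:

* `torusGroundState_of_regularity` (`…TorusGroundStateOfRegularity.lean`): the decl from the
  Perron–Frobenius–Feynman–Kac ground state (`PeriodicGroundStateFeynmanKac_holds`), bounded
  periodisation, the energy identity, translation invariance by uniqueness and the `N = 0` constant
  state, CONDITIONAL on the `C¹`-regularity of Feynman–Kac ground states of bounded measurable
  periodised potentials;
* `stub_periodicGroundStateRegularity` (`…HardCoreExtensionGroundStateRegularity.lean`, line
  `third-law-current-floor` of crux `HardCoreExtension`): that regularity, unconditionally (mild
  Duhamel identity of the Feynman–Kac functional, forward Duhamel identity of the eigenfunction,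
  Gaussian smoothing of bounded measurable data).

[folklore] (Reed–Simon IV Thm XIII.44/XIII.47; Gilbarg–Trudinger Thm 8.8.)
-/

noncomputable section

/-- **`TorusGroundState` holds** (item stmt-AtomisticToContinuum-12606 of route `BECFeynmanVortexArea`):
for every bounded repulsive finite-range pair potential `v`, every `N` and every `L > 0` there is a
periodic `C¹` Bose trial state `Φ` of `N` particles on the torus of side `L` with
`periodicEnergy v Φ = periodicGroundStateEnergy v N L ≠ ⊤`, `Φ` real and strictly positive
everywhere, and `Φ (X + s𝟙) = Φ X` for every common translation `s`. The route decl, by name: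
`torusGroundState_of_regularity` fed with `stub_periodicGroundStateRegularity`.
[cite: ReedSimonIV1978, Thm XIII.47] -/
theorem Summit.AtomisticToContinuum.BoseEinsteinCondensation.Theorems.torusGroundState_proved :
    Summit.AtomisticToContinuum.BoseEinsteinCondensation.Theses.BECFeynmanVortexArea.TorusGroundState :=
  Summit.AtomisticToContinuum.BoseEinsteinCondensation.Theorems.TorusGroundState.torusGroundState_of_regularity
    Summit.AtomisticToContinuum.BoseEinsteinCondensation.Cruxes.HardCoreExtension.ThirdLawCurrentFloor.stub_periodicGroundStateRegularity

end
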